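import Summits.RiemannHypothesis.RiemannHypothesis.Theorems.LiEchoDirichletDefs
import Summits.RiemannHypothesis.RiemannHypothesis.Theorems.LiAsymptoticDefs
import Summits.RiemannHypothesis.RiemannHypothesis.Theorems.LiDirichletTrendDefs
import Literature.NumberTheory.LFunctions.DirichletLZeroCountExplicit
import Literature.NumberTheory.LFunctions.DirichletLRiemannHypothesisUpTo
import Literature.NumberTheory.LFunctions.DirichletArgSBound
import HarnessLib

/-!
# Li theory, PART H — the Dirichlet Li ASYMPTOTIC LAW at finite verified height (rung L-P(P1⁺χ); DRAFT)

RH ladder (D-0040/D-0059/D-0061), column LI, round-5 candidate (iii) «LiDirichletAsymptotic» (theory g7, cell rh-li,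
HOME/theory/TARGETS.md §13.12–13.14).  STATUS: DRAFT FOR THE DIRECTOR'S PICK — constants are PROVISIONAL (derived
in the docstrings, float-checked once in seat over q ≤ 10³⁰, n ≤ 10⁴⁵, T ≥ max(1000, 2√n): sup (budget)/(C √n log(qn)) = 0.827 (BMOR form, C = 1,
n ≥ 900, at q = 3000, n = 900) and 0.908 (tree-only form, C = 15, n ≥ 10⁴; → 12.975/15 as q → ∞); an ET float pass
is requested before filing).
Nothing here bears on the truth of RH or GRH; no new analytic number theory is claimed.

## The statement (χ-transfer of PART C / `Theses/LiAsymptotic.lean`, step for step)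

For a primitive character `χ` mod `q > 1`, Bombieri–Lagarias' real Li coefficient
`Re λ_χ(n) = Σ'_ρ m_ρ Re[1 − (1 − 1/ρ)ⁿ]` (`LiDirichlet.liCoeffCharRe`, absolutely convergent, RH-free) is the
`T → ∞` limit of the box partial sums over `|Im ρ| ≤ T` (`LiDirichlet.tendsto_re_liPartialSum`).  If every zero
with `|Im ρ| ≤ T` lies on the critical line (`LFunctionRHUpTo χ T`, Platt 2016 to height `10⁸/q` for
`q ≤ 400 000`), then for `n ≤ T²/4` the zeros below `T` contribute EXACTLY `m_ρ f_n(|γ|)`,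
`f_n = liWindowWeight n` (PART A), the zeros above `T` are paired `ρ ↔ 1 − ρ̄` (functional equation + reflection;
the χ-PAIR replaces the ζ-QUADRUPLE of `LiBoxTwoSided`, same per-zero constants with a factor 2 to spare) and
compared two-sidedly with RH-free inverse-moment tails, and the window `√n < |γ| ≤ T'` is summed against the
two-sided counting function `N(t, χ)` (`lfunctionZeroCount`), whose smooth part has density `(2/π) g_χ(t)`
(`charGammaDensity`, PART E) and whose remainder is bounded RH-free — crudely in the tree
(`DirichletTheta.abs_lfunctionZeroCount_sub_le`: `5 + 2 log(2q(t+4)ζ(5/4))/log(7/6)`) and sharply in print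
(Bennett–Martin–O'Bryant–Rechnitzer 2021 Thm 1.1 = the tree's NAMED FACT `bmor2021_theorem11`:
`0.22737 ℓ + 2 log(1+ℓ) − 0.5`, `ℓ = log(q(t+2)/2π)`).  Result, UNIFORM in `q`:

  `|Re λ_χ(n) − [(n/2) log n + C₁ n + (n/2) log q]| ≤ C √n log(qn)`,  `n₀ ≤ n ≤ T²/4`,

with `(C, n₀) = (1, 900)` given `bmor2021_theorem11` and `(15, 10⁴)` from the tree's constants alone.  The main
term `charLiMainTerm q n = liMainTerm n + (n/2) log q` is PART F's arithmetic trend `charLiTrendMain χ n` up to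
`≤ 1` (support `CharLiMainTerm_sub_trend`, harmonic-number bookkeeping) — so the law also reads «`Re λ_χ(n)` =
trend + `O(√n log(qn))`», i.e. the oscillating zero part `Re S_χ(n)` of PART F is `O(√n log(qn))` on the verified
range: the Dirichlet analogue of Lagarias 2007 Thm 1.1's RH-shape, at finite height, with explicit constants.
In print: the `O(√n log n)` shape under GRH for the Selberg class (Lagarias 2007 §1; Omar–Bouanani 2009 for
Dirichlet `L`, asymptotics under GRH); an explicit finite-height version is not in print (searches: TARGETS §13.12).

## Contents (defs only + `rfl` sanity; every analytic step is a route item of the Sketch `Theses/LiDirichletAsymptotic`)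

`charLiMainTerm`, `charCountMain`, `charCountMainExact`, `charWeightTrace`, `charLiPartialRe`, `charInvMomentTail`,
`bmorRem`, `argSRem`, the error budgets `charErrFar`, `charErrSmooth`, `charErrOscB/P`, `charErrLowB/P`, the LEAF
`LiDirichletAsymptoticLaw` and its corollary `LiDirichletAsymptoticPlatt` at Platt's height (`q ≤ 10⁵`, `T = 10⁸/q`).
-/

noncomputable section

-- D-0017: `Summit.<S>.<S>.…` is the designed namespace of a single-problem summit.
set_option linter.dupNamespace false

open MeasureTheory intervalIntegral Filter
open scoped Topology

namespace Summit.RiemannHypothesis.RiemannHypothesis.Theorems.LiTheory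

open Literature.NumberTheory.LFunctions Literature.NumberTheory.LFunctions.DirichletTheta

variable {q : ℕ} [NeZero q]

/-! ## Main terms -/

/-- The χ-MAIN TERM `(n/2) log n + C₁ n + (n/2) log q = liMainTerm n + (n/2) log q` (the model integral
`(1/π)∫₀^∞ (1 − cos(n/t)) log(qt/2π) dt`; the conductor enters only through `(log q/π)·∫ f_n = (n/2) log q − (√n/π) log q
+ O(log q)`, the `√n`-term being absorbed by `charCountMainExact χ √n`). -/
def charLiMainTerm (q : ℕ) (n : ℕ) : ℝ :=
  liMainTerm n + (n : ℝ) / 2 * Real.log q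

/-- The closed-form TWO-SIDED Riemann–von Mangoldt main term `(a/π) log(qa/(2πe))` of `N(a, χ)` (BMOR 2021 (1.1)). -/
def charCountMain (q : ℕ) (a : ℝ) : ℝ :=
  a / Real.pi * Real.log (q * a / (2 * Real.pi * Real.exp 1))

/-- The EXACT two-sided main term `(2 θ_κ(a) + a log q)/π`, `θ_κ = gammaArgPhase κ`, `κ = charParity χ` — the one in the
tree's `abs_lfunctionZeroCount_sub_le`; its derivative is `(2/π) charGammaDensity χ` (support `CharCountMainExact_deriv`).
It CANCELS in the assembly (low block `+`, smooth block `−`), so no Stirling bound for `θ_κ` is needed except the one-sided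
`charCountMainExact χ a ≤ charCountMain q a + 1` inside the low-zeros support. -/
def charCountMainExact (χ : DirichletCharacter ℂ q) (a : ℝ) : ℝ :=
  (2 * gammaArgPhase (charParity χ) a + a * Real.log q) / Real.pi

/-! ## Zero-side sums (cumulative in the height, both signs of `Im ρ`, multiplicity `DirichletDisc.zeroOrder`) -/

/-- The window weight COMPLETED AT THE CENTRE: `f_n(t) = 1 − cos(n θ(t))` for `t ≠ 0` (PART A's `liWindowWeight`,
`θ(t) = 2 arctan(1/(2t))`) and its true value `1 − (−1)ⁿ = Re[1 − (1 − 1/ρ)ⁿ]` at a CENTRAL zero `ρ = ½` (`t = 0`, where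
the junk value `arctan (1/0) = 0` would give `0`).  `L(½, χ) = 0` is not excluded by `LFunctionRHUpTo` (and not known to
be impossible), so every finsum over zeros below uses `liWindowWeight₀`; integrals keep `liWindowWeight` (one point). -/
def liWindowWeight₀ (n : ℕ) (t : ℝ) : ℝ :=
  if t = 0 then 1 - (-1 : ℝ) ^ n else liWindowWeight n t

/-- The WEIGHT TRACE `Σ_{|Im ρ| ≤ T} m_ρ f_n(|Im ρ|)`, `f_n = liWindowWeight₀ n` (what an on-line zero contributes to
`Re[1 − (1 − 1/ρ)ⁿ]`; `f_n` is even, `|·|` is cosmetic). -/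
def charWeightTrace (χ : DirichletCharacter ℂ q) (n : ℕ) (T : ℝ) : ℝ :=
  ∑ᶠ ρ ∈ lfunctionZeroBox χ T, (DirichletDisc.zeroOrder χ ρ : ℝ) * liWindowWeight₀ n |ρ.im|

/-- The real part of Li's BOX PARTIAL SUM `Re Σ_{|Im ρ| ≤ T} m_ρ [1 − (1 − 1/ρ)ⁿ]` — literally the function whose
`T → ∞` limit is `LiDirichlet.liCoeffCharRe χ n` (`LiDirichlet.tendsto_re_liPartialSum`); equals
`lfunctionZeroCount χ T − charZeroTrace χ n T` (PART E) termwise. -/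
def charLiPartialRe (χ : DirichletCharacter ℂ q) (n : ℕ) (T : ℝ) : ℝ :=
  (∑ᶠ ρ ∈ lfunctionZeroBox χ T, (DirichletDisc.zeroOrder χ ρ : ℂ) * (1 - (1 - 1 / ρ) ^ n)).re

/-- The inverse-moment sum `Σ_{T < |Im ρ| ≤ U} m_ρ / |Im ρ|^k` over the zeros between two heights. -/
def charInvMomentTail (χ : DirichletCharacter ℂ q) (k : ℕ) (T U : ℝ) : ℝ :=
  ∑ᶠ ρ ∈ lfunctionZeroBox χ U \ lfunctionZeroBox χ T, (DirichletDisc.zeroOrder χ ρ : ℝ) / |ρ.im| ^ k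

/-! ## Counting remainders (RH-free) -/

/-- BMOR remainder INCLUDING the parity offset: `|N(t, χ) − (t/π) log(qt/2πe)| ≤ bmorRem q t :=
0.22737 ℓ + 2 log(1 + ℓ) − 0.25`, `ℓ = bmorEll q t` (Thm 1.1 gives `… − χ(−1)/4` within `0.22737 ℓ + 2 log(1+ℓ) − 0.5`;
valid for `t ≥ 5/7`, `ℓ > 1.567`, automatic for `t ≥ 30`, `q ≥ 2`). -/
def bmorRem (q : ℕ) (t : ℝ) : ℝ :=
  0.22737 * bmorEll q t + 2 * Real.log (1 + bmorEll q t) - 0.25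

/-- The TREE's remainder `|N(t, χ) − charCountMainExact χ t| ≤ argSRem q t := 5 + 12.975 log(9.1902 q (t + 4))`
(`abs_lfunctionZeroCount_sub_le` with `2/log(7/6) ≤ 12.975`, `2 ζ(5/4) ≤ 9.1902`). -/
def argSRem (q : ℕ) (t : ℝ) : ℝ :=
  5 + 12.975 * Real.log (9.1902 * q * (t + 4))

/-! ## Error budgets (PROVISIONAL constants; derivations in the docstrings; `T ≥ 1000`, `n ≤ T²/4`) -/

/-- FAR-ZERO error `2.82 n² · log(qT)/(2πT³) + (n/2) · log(qT)/(πT²)`: `LiBoxTwoSidedChar`'s comparison summed with the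
RH-free tails `Σ_{|γ|>T} m/|γ|⁴ ≤ log(qT)/(2πT³)`, `Σ_{|γ|>T} m/γ|³ ≤ log(qT)/(πT²)` (support `CharFarTails`, from the
two-sided count: main `(1/(3πT³))(log(qT/2πe) + 4/3)` resp. `(1/(2πT²))(log(qT/2πe) + 3/2)` plus `2·argSRem/T^k`). -/
def charErrFar (q : ℕ) (n : ℕ) (T : ℝ) : ℝ :=
  2.82 * (n : ℝ) ^ 2 * (Real.log (q * T) / (2 * Real.pi * T ^ 3))
    + (n : ℝ) / 2 * (Real.log (q * T) / (Real.pi * T ^ 2))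

/-- SMOOTH error `2 log n + 2 log q + 3`: `|(2/π)∫_{√n}^{T'} f_n g_χ − (charLiMainTerm q n − charCountMainExact χ √n)|` for
`T' ≥ n²`, `n ≥ 100` — PART C's `2 log n + 1` for the `½ log(t/2π)` model, plus the conductor channel `(log q/π)∫_{√n}^{T'} f_n =
(n/2) log q − (√n/π) log q + E`, `|E| ≤ (log q/π)(2 + ½ + 1/24) ≤ 0.81 log q` (`|∫₀^{√n} cos(n/t) dt| ≤ 2`, tail `n²/(2T') ≤ ½`,
`n|θ − 1/t| ≤ n/(12t³)`), plus `|½ Re ψ((½+a+it)/2) − ½ log(t/2)| ≤ 1/t²` (`O(1/√n)`); typed with slack as `2 log q + 3`. -/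
def charErrSmooth (q : ℕ) (n : ℕ) : ℝ :=
  2 * Real.log n + 2 * Real.log q + 3

/-- OSCILLATORY (`S`-term) error, BMOR form (`√n ≥ 30`):
`√n·(0.22737 (log q + log(√n + 2)) + 2 log(1 + ℓ(√n)) + 0.42) + 2·bmorRem q √n + 1`, `ℓ(t) = bmorEll q t` —
window identity `Σ_{√n<|γ|≤T'} m f_n = ∫ f_n dN`, `N = (t/π) log(qt/2πe) ± bmorRem`, one integration by parts:
boundary `2·bmorRem q √n` (`f_n ≤ 2`) + `∫_{√n}^∞ (n/t²) bmorRem` (the TOP boundary term `f_n(T')·bmorRem q T' ≤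
(n²/(2T'²))·bmorRem q T'` is carried separately in K3χ and vanishes as `T' → ∞`; the `+ 1` below is slack) —
`∫_{√n}^∞ (n/t²) bmorRem ≤ √n (0.22737(log q − log 2π + log(√n+2) + 1) + 2 log(1+ℓ(√n)) + 2/(1+ℓ(√n)) − 0.25)`. -/
def charErrOscB (q : ℕ) (n : ℕ) : ℝ :=
  Real.sqrt n * (0.22737 * (Real.log q + Real.log (Real.sqrt n + 2))
      + 2 * Real.log (1 + bmorEll q (Real.sqrt n)) + 0.42)
    + 2 * bmorRem q (Real.sqrt n) + 1

/-- OSCILLATORY error, TREE-ONLY form (`√n ≥ 30`): the same integration by parts against `argSRem`: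
`√n·(12.975 (log q + log(√n + 4)) + 46.8) + 2·argSRem q √n + 1`. -/
def charErrOscP (q : ℕ) (n : ℕ) : ℝ :=
  Real.sqrt n * (12.975 * (Real.log q + Real.log (Real.sqrt n + 4)) + 46.8) + 2 * argSRem q (Real.sqrt n) + 1

/-- LOW-ZERO error, BMOR form: the zeros with `|γ| ≤ √n` counted trivially, `0 ≤ Σ m f_n ≤ 2 N(√n, χ)`, centred at
`charCountMainExact χ √n ≤ charCountMain q √n + 1`: `charCountMain q √n + 1 + 2·bmorRem q √n + 1/2`. -/
def charErrLowB (q : ℕ) (n : ℕ) : ℝ :=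
  charCountMain q (Real.sqrt n) + 2 * bmorRem q (Real.sqrt n) + 3 / 2

/-- LOW-ZERO error, TREE-ONLY form: `charCountMain q √n + 1 + 2·argSRem q √n`. -/
def charErrLowP (q : ℕ) (n : ℕ) : ℝ :=
  charCountMain q (Real.sqrt n) + 2 * argSRem q (Real.sqrt n) + 1

/-! ## The rung LEAF L-P(P1⁺χ) and its corollary (DRAFT) -/

/-- **LEAF L-P(P1⁺χ) (RH-FREE, GRH-FREE; DRAFT; new in print as an explicit statement): the Dirichlet Li ASYMPTOTIC
LAW, quadratic range, uniform in the conductor** — for `χ` primitive mod `q > 1`: if every zero of `L(s, χ)` with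
`|Im ρ| ≤ T` (`T ≥ 1000`) lies on the critical line, then for every `n ≤ T²/4`:
`|Re λ_χ(n) − (n/2) log n − C₁ n − (n/2) log q| ≤ 15 √n log(qn)` when `n ≥ 10⁴` (tree constants), and
`≤ √n log(qn)` when `n ≥ 900` GIVEN Bennett–Martin–O'Bryant–Rechnitzer's Theorem 1.1 (`bmor2021_theorem11`, a named fact).
Budget margins (theory g7 float pass, PROVISIONAL): 0.908 and 0.827.  Route sketch `Theses/LiDirichletAsymptotic`
(HOME/theory/route/r5).  KILL: one (q, χ, n, T) in range violating either inequality (RH-free certified numerics: the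
zeros of `L(s, χ)` to height `T' = n²` … impractical; the realistic kill is a refutation of a route item). [folklore] -/
@[conjecture] def LiDirichletAsymptoticLaw : Prop :=
  ∀ (q : ℕ) [NeZero q] (χ : DirichletCharacter ℂ q), χ.IsPrimitive → 1 < q →
    ∀ ⦃T : ℝ⦄, 1000 ≤ T → LFunctionRHUpTo χ T → ∀ ⦃n : ℕ⦄, (n : ℝ) ≤ 1 / 4 * T ^ 2 →
      (10000 ≤ n → |LiDirichlet.liCoeffCharRe χ n - charLiMainTerm q n| ≤ 15 * Real.sqrt n * Real.log (q * n)) ∧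
      (bmor2021_theorem11 → 900 ≤ n →
        |LiDirichlet.liCoeffCharRe χ n - charLiMainTerm q n| ≤ Real.sqrt n * Real.log (q * n))

/-- **COROLLARY at Platt's height** (`platt2016_theorem71`: GRH for primitive `χ` mod `1 < q ≤ 400 000` to height
`plattHeight q ≥ 10⁸/q`; restricted to `q ≤ 10⁵` so that `T = 10⁸/q ≥ 1000`): given BMOR Thm 1.1,
`|Re λ_χ(n) − charLiMainTerm q n| ≤ √n log(qn)` for every `900 ≤ n ≤ 2.5·10¹⁵/q²`.  RH-FREE. [folklore] -/
@[conjecture] def LiDirichletAsymptoticPlatt : Prop :=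
  platt2016_theorem71 → bmor2021_theorem11 →
    ∀ (q : ℕ) [NeZero q] (χ : DirichletCharacter ℂ q), χ.IsPrimitive → 1 < q → q ≤ 100000 →
      ∀ ⦃n : ℕ⦄, 900 ≤ n → (n : ℝ) ≤ 1 / 4 * (10 ^ 8 / (q : ℝ)) ^ 2 →
        |LiDirichlet.liCoeffCharRe χ n - charLiMainTerm q n| ≤ Real.sqrt n * Real.log (q * n)

/-! ## Sanity (`rfl`-level only) -/

example (χ : DirichletCharacter ℂ q) (n : ℕ) (T : ℝ) :
    charLiPartialRe χ n T =
      (∑ᶠ ρ ∈ lfunctionZeroBox χ T, (DirichletDisc.zeroOrder χ ρ : ℂ) * (1 - (1 - 1 / ρ) ^ n)).re := rfl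

example (n : ℕ) : charLiMainTerm 1 n = liMainTerm n := by simp [charLiMainTerm]

/-- The leaf's limit object is the tree's: the box partial sums converge to `liCoeffCharRe` (RH-free). -/
example (χ : DirichletCharacter ℂ q) (hχ : χ.IsPrimitive) (hq : 1 < q) (n : ℕ) :
    Tendsto (charLiPartialRe χ n) atTop (𝓝 (LiDirichlet.liCoeffCharRe χ n)) :=
  LiDirichlet.tendsto_re_liPartialSum hχ hq n

end Summit.RiemannHypothesis.RiemannHypothesis.Theorems.LiTheory

end
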